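import Mathlib
import HarnessLib

/-!
# A second-syzygy module over a finite extension: the dual `Hom_S(D, S)`

Topic `Literature/RingTheory/LocalCohomology`. Let `S ⊆ D` be commutative rings with `D` a domain,
module-finite over the Noetherian domain `S` (the situation of Cohen's structure theorem: a complete
local domain `D` over a complete regular local subring `S`). The `S`-dual `M = Hom_S(D, S)` — the
module underlying the canonical module of `D` when `S` is regular — is naturally a `D`-module
(`(d φ)(x) = φ(d x)`) and, dualising a presentation `S^b → S^a → D → 0`, sits in an exact sequence
`0 → M → S^a → S^b` of `S`-modules: it is a **second syzygy** over `S`. This is the module through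
which the proof of Grothendieck's connectedness theorem (SGA 2 XIII 2.1,
`GrothendieckConnectednessProofs.lean`) reads the local cohomology of the punctured neighbourhoods of
`Spec D`: as a second syzygy it has depth `≥ 2` along every ideal of `S` of grade `≥ 2`, and its `H²`
along an ideal of grade `≥ 3` is finitely generated.

* `exists_dual_syzygy_module` — existence, packaged as an existential over the type `M` with its
  instances (so that no definition is introduced): `M` is a finite `S`-module, a non-zero torsion-free
  `D`-module compatible with the `S`-structure, with `S`-linear maps `M ↪ S^{a+1} → S^{b+1}` exact at
  `S^{a+1}`;
* `isWeaklyRegular_pair_of_exact` — for such an `M` (abstractly: `0 → M → S^a → S^b` exact) an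
  `S`-regular pair `x₁, x₂` is `M`-regular (as elements of `D`);
* `isWeaklyRegular_pi` — an `S`-regular sequence is `S^n`-regular.

Everything is proved; no definitions, no named facts.

## References

* [Grothendieck1968SGA2] A. Grothendieck, SGA 2, Exp. XIII §2 (arXiv:math/0511279, p. 95).
* [BrunsHerzog1998] W. Bruns, J. Herzog, *Cohen–Macaulay rings*, CUP, rev. ed. 1998, Prop. 1.1.2, §1.3–1.4
  (regular sequences under flat base change; syzygies and depth).
-/

noncomputable section

universe u

namespace Literature.RingTheory.LocalCohomology

open RingTheory.Sequence Pointwise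

/-! ## Regular sequences on free modules and on second syzygies -/

section Regular

variable {S : Type u} [CommRing S]

/-- **An `S`-regular sequence is `S^n`-regular** (flat base change of regular sequences to the free
module `S^n = S ⊗ S^n`). [cite: BrunsHerzog1998, Prop. 1.1.2] -/
theorem isWeaklyRegular_pi {rs : List S} (h : IsWeaklyRegular S rs) (n : ℕ) :
    IsWeaklyRegular (Fin n → S) rs :=
  (LinearEquiv.isWeaklyRegular_congr (TensorProduct.lid S (Fin n → S)) rs).mp
    (h.isWeaklyRegular_rTensor (M₂ := Fin n → S))

variable {D : Type u} [CommRing D] [Algebra S D] {M : Type u} [AddCommGroup M] [Module S M]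
  [Module D M] [IsScalarTower S D M] {a b : ℕ} (ι : M →ₗ[S] (Fin a → S))
  (π : (Fin a → S) →ₗ[S] (Fin b → S))

/-- **A regular pair stays regular on a second syzygy.** If `0 → M →ι S^a →π S^b` is exact and `x₁, x₂`
is an `S`-regular sequence, then `x₁, x₂` (read in `D` through the structure map) is an `M`-regular
sequence for the `D`-module `M`: `x₁` is injective on `M ⊆ S^a`; and if `x₂ m = x₁ m₁` then
`ι m ∈ x₁ S^a` (regularity of `x₂` on `S^a/x₁S^a`), say `ι m = x₁ f`, where `x₁ π f = π ι m = 0` forces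
`π f = 0`, `f = ι m₂`, `m = x₁ m₂`. [cite: BrunsHerzog1998, §1.3] -/
theorem isWeaklyRegular_pair_of_exact (hι : Function.Injective ι) (hex : Function.Exact ι π)
    {x₁ x₂ : S} (h : IsWeaklyRegular S [x₁, x₂]) :
    IsWeaklyRegular M [algebraMap S D x₁, algebraMap S D x₂] := by
  have ha := isWeaklyRegular_pi h a
  have hb := isWeaklyRegular_pi h b
  rw [isWeaklyRegular_cons_iff, isWeaklyRegular_cons_iff] at ha hb ⊢
  obtain ⟨ha₁, ha₂, -⟩ := ha
  obtain ⟨hb₁, -, -⟩ := hb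
  refine ⟨?_, ?_, IsWeaklyRegular.nil _ _⟩
  · -- `x₁` is `M`-regular
    rw [isSMulRegular_iff_right_eq_zero_of_smul]
    intro m hm
    rw [algebraMap_smul] at hm
    apply hι
    rw [map_zero]
    exact (isSMulRegular_iff_right_eq_zero_of_smul.mp ha₁) _ (by rw [← LinearMap.map_smul, hm, map_zero])
  · -- `x₂` is `M/x₁M`-regular
    rw [isSMulRegular_quotient_iff_mem_of_smul_mem]
    intro m hm
    rw [Submodule.mem_smul_pointwise_iff_exists] at hm ⊢
    obtain ⟨m₁, -, hm₁⟩ := hm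
    rw [algebraMap_smul, algebraMap_smul] at hm₁
    -- `ι m ∈ x₁ S^a`
    have h1 : x₂ • ι m ∈ x₁ • (⊤ : Submodule S (Fin a → S)) := by
      rw [Submodule.mem_smul_pointwise_iff_exists]
      exact ⟨ι m₁, Submodule.mem_top, by rw [← LinearMap.map_smul, hm₁, LinearMap.map_smul]⟩
    have h2 := (isSMulRegular_quotient_iff_mem_of_smul_mem _ _).mp ha₂ _ h1
    rw [Submodule.mem_smul_pointwise_iff_exists] at h2
    obtain ⟨f, -, hf⟩ := h2
    -- `π f = 0`, so `f = ι m₂`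
    have h3 : π f = 0 := by
      apply (isSMulRegular_iff_right_eq_zero_of_smul.mp hb₁)
      rw [← LinearMap.map_smul, hf]
      exact hex.apply_apply_eq_zero m
    obtain ⟨m₂, hm₂⟩ := (hex f).mp h3
    refine ⟨m₂, Submodule.mem_top, ?_⟩
    rw [algebraMap_smul]
    apply hι
    rw [LinearMap.map_smul, hm₂, hf]

end Regular

/-! ## Existence of the dual syzygy module -/

section Existence

variable (S D : Type u) [CommRing S] [IsDomain S] [IsNoetherianRing S] [CommRing D] [IsDomain D]
  [Algebra S D] [Module.Finite S D]

/-- **The dual syzygy module.** Let `D` be a domain, module-finite over the Noetherian domain `S` with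
`S → D` injective. Then there is a `D`-module `M` (namely `Hom_S(D, S)` with `(d φ)(x) = φ(d x)`), whose
`S`-structure is the restriction of its `D`-structure, which is a finite `S`-module, a non-zero
torsion-free `D`-module, and a second syzygy over `S`: there are `S`-linear maps
`M →ι S^{a+1} →π S^{b+1}` with `ι` injective and `im ι = ker π` (dualise a presentation
`S^{b+1} → S^{a+1} → D → 0`; Mathlib's `range_dualMap_eq_dualAnnihilator_ker_of_surjective`).
Non-vanishing: a non-zero `S`-linear `D → S` is obtained by clearing denominators in a linear form
on the `Frac(S)`-vector space `D ⊗ Frac(S)`; torsion-freeness: a non-zero `d ∈ D` divides a non-zero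
element of `S` (`D` is algebraic over `S`). [cite: BrunsHerzog1998, §1.4] -/
theorem exists_dual_syzygy_module (hinj : Function.Injective (algebraMap S D)) :
    ∃ (M : Type u) (_ : AddCommGroup M) (_ : Module S M) (_ : Module D M) (_ : IsScalarTower S D M),
      Module.Finite S M ∧ Nontrivial M ∧ (∀ (d : D) (m : M), d • m = 0 → d = 0 ∨ m = 0) ∧
      ∃ (a b : ℕ) (ι : M →ₗ[S] (Fin (a + 1) → S)) (π : (Fin (a + 1) → S) →ₗ[S] (Fin (b + 1) → S)),
        Function.Injective ι ∧ Function.Exact ι π := by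
  classical
  -- the `D`-module structure on `M = Hom_S(D, S)`
  letI instSMul : SMul D (D →ₗ[S] S) := ⟨fun d φ => φ ∘ₗ LinearMap.mulLeft S d⟩
  have smul_apply : ∀ (d : D) (φ : D →ₗ[S] S) (x : D), (d • φ) x = φ (d * x) := fun _ _ _ => rfl
  letI instModule : Module D (D →ₗ[S] S) :=
    { one_smul := fun φ => LinearMap.ext fun x => by rw [smul_apply, one_mul]
      mul_smul := fun d e φ => LinearMap.ext fun x => by
        rw [smul_apply, smul_apply, smul_apply, mul_comm d e, mul_assoc]
      smul_zero := fun d => LinearMap.ext fun x => by rw [smul_apply]; rfl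
      smul_add := fun d φ ψ => LinearMap.ext fun x => by
        rw [smul_apply, LinearMap.add_apply, LinearMap.add_apply, smul_apply, smul_apply]
      add_smul := fun d e φ => LinearMap.ext fun x => by
        rw [smul_apply, LinearMap.add_apply, smul_apply, smul_apply, add_mul, map_add]
      zero_smul := fun φ => LinearMap.ext fun x => by
        rw [smul_apply, zero_mul, map_zero, LinearMap.zero_apply] }
  haveI instTower : IsScalarTower S D (D →ₗ[S] S) := ⟨fun s d φ => LinearMap.ext fun x => by
    rw [smul_apply, LinearMap.smul_apply, smul_apply, smul_mul_assoc, LinearMap.map_smul]⟩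
  -- a presentation `S^{b+1} →q S^{a+1} →p D → 0`
  obtain ⟨a, p₀, hp₀⟩ := Module.Finite.exists_fin' S D
  let p : (Fin (a + 1) → S) →ₗ[S] D := p₀ ∘ₗ LinearMap.funLeft S S Fin.castSucc
  have hp : Function.Surjective p :=
    hp₀.comp (LinearMap.funLeft_surjective_of_injective S S _ (Fin.castSucc_injective a))
  obtain ⟨b, q₀, hq₀⟩ := Module.Finite.exists_fin' S (LinearMap.ker p)
  let q : (Fin (b + 1) → S) →ₗ[S] (Fin (a + 1) → S) :=
    (LinearMap.ker p).subtype ∘ₗ q₀ ∘ₗ LinearMap.funLeft S S Fin.castSucc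
  have hq : LinearMap.range q = LinearMap.ker p := by
    have hq' : Function.Surjective (q₀ ∘ₗ LinearMap.funLeft S S Fin.castSucc) :=
      hq₀.comp (LinearMap.funLeft_surjective_of_injective S S _ (Fin.castSucc_injective b))
    apply le_antisymm
    · rintro _ ⟨v, rfl⟩
      exact (q₀ (LinearMap.funLeft S S Fin.castSucc v)).2
    · intro w hw
      obtain ⟨v, hv⟩ := hq' ⟨w, hw⟩
      exact ⟨v, by change ((q₀ ∘ₗ LinearMap.funLeft S S Fin.castSucc) v : Fin (a + 1) → S) = w; rw [hv]⟩
  have hpq : ∀ v, p (q v) = 0 := fun v => LinearMap.mem_ker.mp (hq ▸ LinearMap.mem_range_self q v)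
  -- dualise
  let ea : Module.Dual S (Fin (a + 1) → S) ≃ₗ[S] (Fin (a + 1) → S) :=
    (Pi.basisFun S (Fin (a + 1))).toDualEquiv.symm
  let eb : Module.Dual S (Fin (b + 1) → S) ≃ₗ[S] (Fin (b + 1) → S) :=
    (Pi.basisFun S (Fin (b + 1))).toDualEquiv.symm
  let ι : (D →ₗ[S] S) →ₗ[S] (Fin (a + 1) → S) := ea.toLinearMap ∘ₗ p.dualMap
  let π : (Fin (a + 1) → S) →ₗ[S] (Fin (b + 1) → S) :=
    eb.toLinearMap ∘ₗ q.dualMap ∘ₗ ea.symm.toLinearMap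
  have hι : Function.Injective ι :=
    ea.injective.comp (LinearMap.dualMap_injective_of_surjective hp)
  have hex : Function.Exact ι π := by
    intro w
    constructor
    · intro hw
      set θ : Module.Dual S (Fin (a + 1) → S) := ea.symm w with hθdef
      have hθ0 : q.dualMap θ = 0 := by
        apply eb.injective
        rw [map_zero]
        exact hw
      have hθ : θ ∈ (LinearMap.ker p).dualAnnihilator := by
        rw [Submodule.mem_dualAnnihilator]
        intro v hv
        rw [← hq] at hv
        obtain ⟨v', rfl⟩ := hv
        have := LinearMap.congr_fun hθ0 v'
        rwa [LinearMap.dualMap_apply, LinearMap.zero_apply] at this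
      rw [← LinearMap.range_dualMap_eq_dualAnnihilator_ker_of_surjective p hp] at hθ
      obtain ⟨ψ, hψ⟩ := hθ
      refine ⟨ψ, ?_⟩
      change ea (p.dualMap ψ) = w
      rw [hψ, hθdef, LinearEquiv.apply_symm_apply]
    · rintro ⟨ψ, rfl⟩
      change eb (q.dualMap (ea.symm (ea (p.dualMap ψ)))) = 0
      rw [LinearEquiv.symm_apply_apply]
      convert map_zero eb
      apply LinearMap.ext
      intro v
      rw [LinearMap.dualMap_apply, LinearMap.dualMap_apply, hpq, map_zero, LinearMap.zero_apply]
  -- torsion-free over `D`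
  have htf : ∀ (d : D) (φ : D →ₗ[S] S), d • φ = 0 → d = 0 ∨ φ = 0 := by
    intro d φ h
    by_cases hd : d = 0
    · exact Or.inl hd
    refine Or.inr (LinearMap.ext fun x => ?_)
    obtain ⟨c, s, hs, hsc⟩ := Algebra.IsAlgebraic.exists_smul_eq_mul S (1 : D) hd
    have h1 : s • φ x = 0 := by
      rw [← LinearMap.map_smul, show s • x = (s • (1 : D)) * x by rw [smul_mul_assoc, one_mul], hsc,
        mul_assoc, ← smul_apply, h, LinearMap.zero_apply]
    rw [LinearMap.zero_apply]
    exact (smul_eq_zero.mp h1).resolve_left hs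
  -- non-vanishing: a non-zero `S`-linear form on `D`
  have hnt : Nontrivial (D →ₗ[S] S) := by
    let K := FractionRing S
    let V := LocalizedModule (nonZeroDivisors S) D
    have hv : (LocalizedModule.mk 1 1 : V) ≠ 0 := by
      intro h
      rw [← LocalizedModule.zero_mk 1, LocalizedModule.mk_eq] at h
      obtain ⟨u, hu⟩ := h
      simp only [smul_zero, one_smul] at hu
      have hu' : algebraMap S D u = 0 := by rwa [Algebra.algebraMap_eq_smul_one]
      exact nonZeroDivisors.ne_zero u.2 (hinj (by rw [hu', map_zero]))
    obtain ⟨f, hf⟩ := Module.Projective.exists_dual_ne_zero K hv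
    -- clear denominators on the generators `p (e_i)`
    obtain ⟨den, hden⟩ := IsLocalization.exist_integer_multiples_of_finite (nonZeroDivisors S)
      (fun i : Fin (a + 1) => f (LocalizedModule.mk (p (Pi.single i 1)) 1))
    have hint : ∀ d : D, ∃ t : S, algebraMap S K t = (den : S) • f (LocalizedModule.mk d 1) := by
      intro d
      obtain ⟨g, rfl⟩ := hp d
      have hg : p g = ∑ i, g i • p (Pi.single i 1) := by
        conv_lhs => rw [← Finset.univ_sum_single g]
        rw [map_sum]
        refine Finset.sum_congr rfl fun i _ => ?_
        rw [← LinearMap.map_smul, ← Pi.single_smul, smul_eq_mul, mul_one]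
      have hmk : (LocalizedModule.mk (p g) 1 : V) =
          ∑ i, g i • LocalizedModule.mk (p (Pi.single i 1)) 1 := by
        rw [hg, ← LocalizedModule.mkLinearMap_apply, map_sum]
        refine Finset.sum_congr rfl fun i _ => ?_
        rw [LinearMap.map_smul_of_tower]
        rfl
      have hsum : (den : S) • f (LocalizedModule.mk (p g) 1) =
          ∑ i, g i • ((den : S) • f (LocalizedModule.mk (p (Pi.single i 1)) 1)) := by
        rw [hmk, map_sum, Finset.smul_sum]
        refine Finset.sum_congr rfl fun i _ => ?_
        rw [LinearMap.map_smul_of_tower, smul_comm]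
      rw [hsum]
      have : IsLocalization.IsInteger S
          (∑ i, g i • ((den : S) • f (LocalizedModule.mk (p (Pi.single i 1)) 1))) := by
        refine Finset.sum_induction _ (IsLocalization.IsInteger S) (fun x y hx hy => ?_) ?_ ?_
        · exact IsLocalization.isInteger_add hx hy
        · exact ⟨0, by simp⟩
        · intro i _
          exact IsLocalization.isInteger_smul (hden i)
      obtain ⟨t, ht⟩ := this
      exact ⟨t, ht⟩
    choose φf hφf using hint
    have hKinj : Function.Injective (algebraMap S K) := IsFractionRing.injective S K
    let φ : D →ₗ[S] S :=
      { toFun := φf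
        map_add' := fun d d' => hKinj (by
          rw [map_add, hφf, hφf, hφf, ← smul_add, ← map_add,
            show (LocalizedModule.mk (d + d') 1 : V) = LocalizedModule.mk d 1 + LocalizedModule.mk d' 1
              from (LocalizedModule.mkLinearMap (nonZeroDivisors S) D).map_add d d'])
        map_smul' := fun s d => hKinj (by
          rw [RingHom.id_apply, smul_eq_mul, map_mul, hφf, hφf, ← Algebra.smul_def,
            ← LocalizedModule.smul'_mk, LinearMap.map_smul_of_tower, smul_comm]) }
    have hφ1 : φ 1 ≠ 0 := by
      intro h0
      have h1 : algebraMap S K (φf 1) = 0 := by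
        change algebraMap S K (φ 1) = 0
        rw [h0, map_zero]
      rw [hφf, Algebra.smul_def, mul_eq_zero] at h1
      rcases h1 with h1 | h1
      · exact IsFractionRing.to_map_ne_zero_of_mem_nonZeroDivisors den.2 h1
      · exact hf h1
    exact ⟨⟨φ, 0, fun h => hφ1 (by rw [h, LinearMap.zero_apply])⟩⟩
  -- finiteness over `S`
  have hfin : Module.Finite S (D →ₗ[S] S) := Module.Finite.of_injective ι hι
  exact ⟨D →ₗ[S] S, inferInstance, inferInstance, instModule, instTower, hfin, hnt, htf, a, b, ι, π,
    hι, hex⟩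

end Existence

end Literature.RingTheory.LocalCohomology

end
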